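import Summits.QuantumFields.BalabanUV.Beta.GAN24.TopLagrangeKSlot
import Summits.QuantumFields.BalabanUV.Beta.GAN24.TaylorLamBracketSymAt

/-!
# Road «S3-Taylor», rows S3-Lt ∕ R3-dLt AT THE SYM TABLE: the top Λ piece of every member, for the SYMMETRISED increment `symLagrIncAt d (toSite r) Lc`, is ONE fixed
# trilinear functional **`lamTopKerAt (toSite r) Lc`** (THIS namespace) of the unit step resolvent (sym twin of leaf-06's (ρ) `TopLagrangeKSlotAt` ∕ leaf-04 g19's `TopLagrangeKSlot`;
# the table enters ONLY through an1's `symHessFFAt (toSite r) Lc` in the middle slot `lamTopMidAt`)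

NOT IN PRINT — OUR BOOKKEEPING (road-P2 = `b2b-balaban-gan24-p2` gen 56, 2026-08-25; row G-an2-4 ∕ (CONV-C), the (α-0) chain at row D1's literal
OF RECORD (III′) `JsB12CombShSym`; [folklore] composition BY NAME; 0 cite, 0 `def … : Prop`, 0 `sorry`).  Weight 0.  NEVER «G-an2-4 closed» as (CONV-C);
NOT D1, NOT BetaPertH, NOT continuum, NOT Clay; NO campaign opened (an2 W-4) — typed while idle under R-2 as a brick of the located «SYM-S3-Λ-DIFF» transfer
(the UNDRESSED top-aligned PAIR letter of the (III′) Λ-born RATE half `hBd-Λ`, road-P2 MEMO M-gan24p2-g56-1, `gen56/S-CAMPAIGN-SIZING-g56.v0_7.md` §2(c)).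

METHOD = the OWNER gan24-p1's gen-6 `mkroot.py` rule (road-P2's `tools/mksym.py`): leaf-06 g41's «ROOTED-S3-Λ-DIFF» file VERBATIM with an1's SYM table
`symHessFFAt (toSite r) Lc` (`r ∈ box (d+1) Lc`; `SymAveragingHessianCounts`: SAME support `symHessKerAt_eq_zero_left ∕ _right`, SAME entry bound
`abs_symHessKerAt_le ≤ 2ℓ²`, SAME bi-localisation `biLoc_symHessFFAt` as the rooted table) in place of `hessFFAt (toSite r) Lc`, and the symmetrised increment
`E3UnitSplitLevelsSymAt.symLagrIncAt` (M.66) in place of `SpineRooted.lagrIncAt`; every ROOT-FREE lemma of the base modules is used BY NAME (not re-declared);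
same theorem names in this file's namespace; base and rooted modules untouched; no zero-root sanity `example` (the sym table has no root-0 base twin).
Discharges NOTHING of (hS, hSall), the K-slot, hBdev or BetaPertH by itself.

## Contents (`d` generic; root `r ∈ box (d+1) Lc`; 2 bookkeeping `def`s — OUR objects, asserting nothing: `lamTopMidAt ρ Lc K` (the middle slot: the superposition of
an1's symmetrised one-step constraint Hessians against `K`'s `mm` block) and `lamTopKerAt ρ Lc K₁ K₂ K₃` (the trilinear functional); the rooted file's defs of the same
short names live in the namespace `TopLagrangeKSlotAt` — no collision)
§1-σ `lamTopMid_apply`, `lamTopMid_inr ∕ _inl_inr` (ff-only: `symHessFFAt_inr ∕ _inl_inr`), `legScale_mul_lamTopMid_mul_legScale`, `lamTopMid_unitK`, `lamTopKer_unitK`;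
§2-σ `summable_lamTopMid_term`, `lamTopMid_sub`, `biLoc_lamTopMid` (constant `TopLagrangeKSlot.midConst` — the SAME as rooted: `biLoc_symHessFFAt`);
§3-σ `vertexOf_lagrInc_top` (`vertex_symLagrIncAt_top`, M.66), `wPhiMid_eq_lamTopMid`, `e3OfS_lamTop_eq`, **`unit_e3OfS_lamTop_eq`** (the unit-rescaled top Λ piece of member
`j+2` `= lamTopKerAt (toSite r) Lc 𝔻K_{j+2} 𝔻K_{j+2} 𝔻K_{j+2}`).
-/

noncomputable section

open Finset
open scoped BigOperators
open Literature.MathematicalPhysics.QuantumFieldTheory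
open Literature.MathematicalPhysics.QuantumFieldTheory.Balaban1983to89
open Literature.MathematicalPhysics.QuantumFieldTheory.Balaban1983to89.Beta
open B12Sec2to5 (l1 l1_nonneg)
open ExpKernelCalculus (MKer Decays BiLoc comp Zl Zl_nonneg l1_sub_symm l1_natSmul biLoc_comp_decays summable_exp_shift)
open KernelSpecInstance (wH wΦ decay_wΦ)
open OneStepResolventKernel (Fib KInv wsum vertexOf LocStencil KInv_inr_inr_coarse decays_KInv decays_mono biLoc_mono)
open OneStepKernelFamily (dec KInvStep decays_KInvStep)
open InterLevelTransport (avgLift cwsum cwsum_apply biLoc_cwsum dec_comp_avgLift_comp)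
open AffineAveraging (box toSite)
open AveragingHessianKernels (ell)
open Summit.QuantumFields.BalabanUV.Beta.SymAveragingHessianCounts (symHessFFAt symHessKerAt symHessFFAt_inl_inl symHessFFAt_inl_inr symHessFFAt_inr
  symHessKerAt_eq_zero_left symHessKerAt_eq_zero_right abs_symHessKerAt_le biLoc_symHessFFAt)
open Summit.QuantumFields.BalabanUV.Beta.GAN24.E3UnitSplitLevelsSymAt (symLagrIncAt)
open BalabanStepJetsSucc (mmRead mmRead_inl_inl mmRead_inr_left mmRead_inr_right mmRead_eq_dec biLoc_mmRead biLoc_comp_right)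
open BalabanStepW2 (mmRead_mul_eq_mmRead_dec)
open DecLiftAdjoint (vertexOf_smul avgLift_finset_sum avgLift_wsum)
open KernelWard (Bdd bdd_of_decays bdd_of_biLoc biLoc_add slices_bdd_biLoc slices_biLoc_bdd comp_sub_left comp_sub_right)
open HessKerRate (comp_sub_comp biLoc_comp_sub_comp)
open Summit.QuantumFields.BalabanUV.Beta.HessKerDressedUnits (unitK legScale unitK_apply legScale_inl legScale_inr)
open Summit.QuantumFields.BalabanUV.Beta.SecondOrderUnits (KInvStep_mm_eq_KInv_mm)
open Summit.QuantumFields.BalabanUV.Beta.GAN24.E3UnitSplit (e3OfS)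
open Summit.QuantumFields.BalabanUV.Beta.GAN24.TaylorLamBracketSymAt (vertex_symLagrIncAt_top)
open Summit.QuantumFields.BalabanUV.Beta.GAN24.ThirdJetKernel (mmRead_smul mmRead_sub)
open Summit.QuantumFields.BalabanUV.Beta.GAN24.TopLagrangeKSlot (midConst midConst_nonneg mmRead_pow_succ weight_arith)

namespace Summit.QuantumFields.BalabanUV.Beta.GAN24.TopLagrangeKSlotSymAt

variable {d : ℕ}

/-! ## §1 The `mm`-coefficient superposition and the trilinear functional -/

section Objects

variable {Lc : ℕ} [NeZero Lc] {r : Fin (d + 1) → ℕ}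

/-- [folklore] **THE MIDDLE SLOT**: the superposition of an1's SYMMETRISED one-step constraint Hessians `symHessFFAt ρ Lc μ yy` (level-`M` kernels, `ff`-only,
localised at `Lc•yy`) with COEFFICIENTS THE `mm` BLOCK OF `K` at `Lc`-dilated points:
`lamTopMidAt (toSite r) Lc K κ′ u′ := Σ_μ cwsum Lc (yy ↦ K (Lc•u′) (Lc•yy) (inr κ′) (inr μ)) (symHessFFAt (toSite r) Lc μ)`.  For `K = KInvStep Lc j` the coefficients are
`wΦ_{Lc^{j+1}} κ′ μ (u′ − yy)` (`wPhiMid_eq_lamTopMid`).  A plumbing definition; asserts nothing. -/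
def lamTopMidAt (ρ : Fin (d + 1) → ℤ) (Lc : ℕ) (K : MKer (d + 1) (Fib d)) (κ' : Fin (d + 1)) (u' : Fin (d + 1) → ℤ) :
    MKer (d + 1) (Fib d) :=
  fun w y a b => ∑ μ : Fin (d + 1),
    cwsum Lc (fun yy => K ((Lc : ℤ) • u') ((Lc : ℤ) • yy) (Sum.inr κ') (Sum.inr μ)) (symHessFFAt ρ Lc μ) w y a b

/-- [folklore] **THE TRILINEAR FUNCTIONAL OF THE TOP Λ PIECE**: `lamTopKerAt (toSite r) Lc K₁ K₂ K₃ κ′ u′ := −mmRead Lc (K₁ ∘ lamTopMidAt (toSite r) Lc K₂ κ′ u′ ∘ K₃)` —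
the `mm` block of the triple composition read at `Lc`-dilated points, placed in the `ff` slot (an2's `mmRead`).  At `K₁ = K₂ = K₃ = KInvStep Lc j` it
is the top Λ piece of member `j+1` up to its scalar weight (`e3OfS_lamTop_eq`).  A plumbing definition; asserts nothing. -/
def lamTopKerAt (ρ : Fin (d + 1) → ℤ) (Lc : ℕ) (K₁ K₂ K₃ : MKer (d + 1) (Fib d)) (κ' : Fin (d + 1)) (u' : Fin (d + 1) → ℤ) :
    MKer (d + 1) (Fib d) :=
  fun x' z' a b => -(mmRead Lc (comp (comp K₁ (lamTopMidAt ρ Lc K₂ κ' u')) K₃) x' z' a b)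

/-- [folklore] The middle slot as an explicit coarse sum. -/
theorem lamTopMid_apply (K : MKer (d + 1) (Fib d)) (κ' : Fin (d + 1)) (u' w y : Fin (d + 1) → ℤ) (a b : Fib d) :
    lamTopMidAt (toSite r) Lc K κ' u' w y a b =
      ∑ μ : Fin (d + 1), ∑' yy : Fin (d + 1) → ℤ,
        K ((Lc : ℤ) • u') ((Lc : ℤ) • yy) (Sum.inr κ') (Sum.inr μ) * symHessFFAt (toSite r) Lc μ yy w y a b := by
  simp only [lamTopMidAt, cwsum_apply]

/-- [folklore] The middle slot is `ff`-only: a multiplier LEFT leg reads `0` (`symHessFFAt_inr`). -/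
@[simp] theorem lamTopMid_inr_left (K : MKer (d + 1) (Fib d)) (κ' : Fin (d + 1)) (u' w y : Fin (d + 1) → ℤ) (μ' : Fin (d + 1))
    (b : Fib d) : lamTopMidAt (toSite r) Lc K κ' u' w y (Sum.inr μ') b = 0 := by
  simp [lamTopMid_apply, symHessFFAt_inr]

/-- [folklore] The middle slot is `ff`-only: a multiplier RIGHT leg reads `0` (`symHessFFAt_inl_inr`). -/
@[simp] theorem lamTopMid_inl_inr (K : MKer (d + 1) (Fib d)) (κ' : Fin (d + 1)) (u' w y : Fin (d + 1) → ℤ) (α μ' : Fin (d + 1)) :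
    lamTopMidAt (toSite r) Lc K κ' u' w y (Sum.inl α) (Sum.inr μ') = 0 := by
  simp [lamTopMid_apply, symHessFFAt_inl_inr]

/-- [folklore] Any RIGHT multiplier leg of the middle slot reads `0`. -/
@[simp] theorem lamTopMid_inr_right (K : MKer (d + 1) (Fib d)) (κ' : Fin (d + 1)) (u' w y : Fin (d + 1) → ℤ) (a : Fib d)
    (μ' : Fin (d + 1)) : lamTopMidAt (toSite r) Lc K κ' u' w y a (Sum.inr μ') = 0 := by
  rcases a with α | ν
  · exact lamTopMid_inl_inr K κ' u' w y α μ'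
  · exact lamTopMid_inr_left K κ' u' w y ν _

/-- [folklore] UNITS, middle slot entries: `ℓ(a)·V(a,b)·ℓ(b) = sf²·V(a,b)` for the K-slot leg scale `ℓ = legScale sf sm` (field legs `sf`,
multiplier legs `sm`) — the middle slot has field legs only. -/
theorem legScale_mul_lamTopMid_mul_legScale (sf sm : ℝ) (K : MKer (d + 1) (Fib d)) (κ' : Fin (d + 1))
    (u' w y : Fin (d + 1) → ℤ) (a b : Fib d) :
    legScale (d := d) sf sm a * lamTopMidAt (toSite r) Lc K κ' u' w y a b * legScale (d := d) sf sm b = sf ^ 2 * lamTopMidAt (toSite r) Lc K κ' u' w y a b := by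
  rcases a with α | μ'
  · rcases b with β | ν
    · simp only [legScale_inl]; ring
    · simp
  · simp

/-- [folklore] UNITS, middle slot coefficients: `lamTopMidAt (toSite r) Lc (unitK sf sm K) = sm² • lamTopMidAt (toSite r) Lc K` (the coefficients are `mm` entries). -/
theorem lamTopMid_unitK (sf sm : ℝ) (K : MKer (d + 1) (Fib d)) (κ' : Fin (d + 1)) (u' : Fin (d + 1) → ℤ) :
    lamTopMidAt (toSite r) Lc (unitK sf sm K) κ' u' = (sm ^ 2) • lamTopMidAt (toSite r) Lc K κ' u' := by
  funext w y a b
  simp only [lamTopMid_apply, unitK_apply, legScale_inr, Pi.smul_apply, smul_eq_mul, Finset.mul_sum]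
  refine Finset.sum_congr rfl fun μ _ => ?_
  rw [← tsum_mul_left]
  refine tsum_congr fun yy => ?_
  ring

/-- [folklore] **UNITS OF THE TRILINEAR FUNCTIONAL**: rescaling all three slots by the K-slot units (`unitK sf sm`: field legs `×sf`, multiplier
legs `×sm`) multiplies `lamTopKer` by `sf²·sm⁴` — the legs met are `(inr,inl)·(inr,inr)·(inl,inr)` (outer reads `mm`, the middle slot is
`ff`-only with `mm` coefficients). -/
theorem lamTopKer_unitK (sf sm : ℝ) (K₁ K₂ K₃ : MKer (d + 1) (Fib d)) (κ' : Fin (d + 1)) (u' : Fin (d + 1) → ℤ) :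
    lamTopKerAt (toSite r) Lc (unitK sf sm K₁) (unitK sf sm K₂) (unitK sf sm K₃) κ' u' =
      (sf ^ 2 * sm ^ 4) • lamTopKerAt (toSite r) Lc K₁ K₂ K₃ κ' u' := by
  funext x' z' a b
  rcases a with α | μ'
  · rcases b with β | ν
    · simp only [lamTopKerAt, mmRead_inl_inl, Pi.smul_apply, smul_eq_mul, lamTopMid_unitK, mul_neg]
      congr 1
      simp only [comp, unitK_apply, legScale_inr, Pi.smul_apply, smul_eq_mul]
      rw [← tsum_mul_left]
      refine tsum_congr fun y => ?_
      rw [Finset.mul_sum]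
      refine Finset.sum_congr rfl fun g _ => ?_
      rw [← tsum_mul_right, ← tsum_mul_right, ← tsum_mul_left]
      refine tsum_congr fun w => ?_
      rw [Finset.sum_mul, Finset.sum_mul, Finset.mul_sum]
      refine Finset.sum_congr rfl fun f _ => ?_
      have hV := legScale_mul_lamTopMid_mul_legScale (Lc := Lc) (r := r) sf sm K₂ κ' u' w y f g
      calc sm * K₁ ((Lc : ℤ) • x') w (Sum.inr α) f * legScale (d := d) sf sm f * (sm ^ 2 * lamTopMidAt (toSite r) Lc K₂ κ' u' w y f g) *
            (legScale (d := d) sf sm g * K₃ y ((Lc : ℤ) • z') g (Sum.inr β) * sm)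
          = sm ^ 4 * K₁ ((Lc : ℤ) • x') w (Sum.inr α) f *
              (legScale (d := d) sf sm f * lamTopMidAt (toSite r) Lc K₂ κ' u' w y f g * legScale (d := d) sf sm g) *
                K₃ y ((Lc : ℤ) • z') g (Sum.inr β) := by ring
        _ = sf ^ 2 * sm ^ 4 * (K₁ ((Lc : ℤ) • x') w (Sum.inr α) f * lamTopMidAt (toSite r) Lc K₂ κ' u' w y f g *
              K₃ y ((Lc : ℤ) • z') g (Sum.inr β)) := by rw [hV]; ring
    · simp only [lamTopKerAt, mmRead_inr_right, neg_zero, Pi.smul_apply, smul_eq_mul, mul_zero]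
  · simp only [lamTopKerAt, mmRead_inr_left, neg_zero, Pi.smul_apply, smul_eq_mul, mul_zero]

omit [NeZero Lc] in
/-- [folklore] Summability of the middle slot's coarse sum (decaying coefficients × bounded finite-range tables). -/
theorem summable_lamTopMid_term (hLc : 1 ≤ Lc) (hr : r ∈ box (d + 1) Lc) {K : MKer (d + 1) (Fib d)} {C δ : ℝ} (hK : Decays K C δ) (hδ : 0 < δ)
    (κ' μ : Fin (d + 1)) (u' w y : Fin (d + 1) → ℤ) (a b : Fib d) :
    Summable fun yy : Fin (d + 1) → ℤ =>
      K ((Lc : ℤ) • u') ((Lc : ℤ) • yy) (Sum.inr κ') (Sum.inr μ) * symHessFFAt (toSite r) Lc μ yy w y a b := by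
  have hC : 0 ≤ C := hK.nonneg (Sum.inl 0)
  refine Summable.of_norm_bounded ((summable_exp_shift hδ u').mul_left (C * (2 * (ell (d + 1) Lc : ℝ) ^ 2)))
    (fun yy => ?_)
  rw [Real.norm_eq_abs, abs_mul]
  have h1 := hK ((Lc : ℤ) • u') ((Lc : ℤ) • yy) (Sum.inr κ') (Sum.inr μ)
  have h2 : |symHessFFAt (toSite r) (d := d) Lc μ yy w y a b| ≤ 2 * (ell (d + 1) Lc : ℝ) ^ 2 := by
    simpa using biLoc_symHessFFAt (d := d) hLc μ yy hr le_rfl w y a b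
  have h3 : Real.exp (-δ * l1 ((Lc : ℤ) • u' - (Lc : ℤ) • yy)) ≤ Real.exp (-δ * l1 (u' - yy)) := by
    rw [Real.exp_le_exp, ← smul_sub, l1_natSmul]
    have hL : (1 : ℝ) ≤ Lc := by exact_mod_cast hLc
    have hp : 0 ≤ δ * l1 (u' - yy) * ((Lc : ℝ) - 1) :=
      mul_nonneg (mul_nonneg hδ.le (l1_nonneg (u' - yy))) (sub_nonneg.2 hL)
    nlinarith [hp]
  calc |K ((Lc : ℤ) • u') ((Lc : ℤ) • yy) (Sum.inr κ') (Sum.inr μ)| * |symHessFFAt (toSite r) (d := d) Lc μ yy w y a b|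
      ≤ C * Real.exp (-δ * l1 ((Lc : ℤ) • u' - (Lc : ℤ) • yy)) * (2 * (ell (d + 1) Lc : ℝ) ^ 2) :=
        mul_le_mul h1 h2 (abs_nonneg _) (mul_nonneg hC (Real.exp_pos _).le)
    _ ≤ C * Real.exp (-δ * l1 (u' - yy)) * (2 * (ell (d + 1) Lc : ℝ) ^ 2) := by
        have h0 : (0 : ℝ) ≤ 2 * (ell (d + 1) Lc : ℝ) ^ 2 := by positivity
        exact mul_le_mul_of_nonneg_right (mul_le_mul_of_nonneg_left h3 hC) h0
    _ = C * (2 * (ell (d + 1) Lc : ℝ) ^ 2) * Real.exp (-δ * l1 (u' - yy)) := by ring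

/-- [folklore] **LINEARITY OF THE MIDDLE SLOT** (decaying coefficients): `lamTopMidAt (toSite r) Lc K′ − lamTopMidAt (toSite r) Lc K = lamTopMidAt (toSite r) Lc (K′ − K)`. -/
theorem lamTopMid_sub (hLc : 1 ≤ Lc) (hr : r ∈ box (d + 1) Lc) {K K' : MKer (d + 1) (Fib d)} {C C' δ : ℝ} (hK : Decays K C δ) (hK' : Decays K' C' δ)
    (hδ : 0 < δ) (κ' : Fin (d + 1)) (u' : Fin (d + 1) → ℤ) :
    lamTopMidAt (toSite r) Lc K' κ' u' - lamTopMidAt (toSite r) Lc K κ' u' = lamTopMidAt (toSite r) Lc (K' - K) κ' u' := by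
  funext w y a b
  simp only [Pi.sub_apply, lamTopMid_apply]
  rw [← Finset.sum_sub_distrib]
  refine Finset.sum_congr rfl fun μ _ => ?_
  rw [← (summable_lamTopMid_term hLc hr hK' hδ κ' μ u' w y a b).tsum_sub (summable_lamTopMid_term hLc hr hK hδ κ' μ u' w y a b)]
  refine tsum_congr fun yy => ?_
  ring

/-- [folklore] **THE MIDDLE SLOT IS BI-LOCALISED** at the dilated bond `(Lc•u′, Lc•u′)`: coefficients decaying like `C·e^{−δ|·|₁}` (a `Decays` bound on
`K` read on its `mm` block) against an1's tables bi-localised at `Lc•yy` (`biLoc_symHessFFAt`) — an2's `biLoc_cwsum`, summed over `μ`; constant `midConst`,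
rate `δ/2`. -/
theorem biLoc_lamTopMid (hLc : 1 ≤ Lc) (hr : r ∈ box (d + 1) Lc) {K : MKer (d + 1) (Fib d)} {C δ : ℝ} (hK : Decays K C δ) (hδ : 0 < δ) (κ' : Fin (d + 1))
    (u' : Fin (d + 1) → ℤ) :
    BiLoc (lamTopMidAt (toSite r) Lc K κ' u') ((Lc : ℤ) • u') ((Lc : ℤ) • u') (midConst d Lc C δ) (δ / 2) := by
  have hC : 0 ≤ C := hK.nonneg (Sum.inl 0)
  have h : ∀ μ : Fin (d + 1), BiLoc (cwsum Lc (fun yy => K ((Lc : ℤ) • u') ((Lc : ℤ) • yy) (Sum.inr κ') (Sum.inr μ)) (symHessFFAt (toSite r) Lc μ))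
      ((Lc : ℤ) • u') ((Lc : ℤ) • u')
      (C * (2 * (ell (d + 1) Lc : ℝ) ^ 2 * Real.exp (4 * ((d : ℝ) + 1) * Lc * δ)) * Zl (d + 1) (δ / 2)) (δ / 2) := by
    intro μ
    refine biLoc_cwsum (N := Lc) (fun yy => ?_) (fun yy => biLoc_symHessFFAt (d := d) hLc μ yy hr hδ.le) hδ hC
    rw [l1_sub_symm]
    exact hK _ _ _ _
  have hs := OneStepResolventKernel.biLoc_finset_sum Finset.univ (fun μ _ => h μ)
  simp only [Finset.sum_const, Finset.card_univ, Fintype.card_fin, nsmul_eq_mul] at hs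
  intro w y a b
  have e : lamTopMidAt (toSite r) Lc K κ' u' w y a b = ∑ μ : Fin (d + 1),
      cwsum Lc (fun yy => K ((Lc : ℤ) • u') ((Lc : ℤ) • yy) (Sum.inr κ') (Sum.inr μ)) (symHessFFAt (toSite r) Lc μ) w y a b := rfl
  rw [e]
  exact hs w y a b

end Objects

/-! ## §2 The identity: the top Λ piece of member `j+1` is `lamTopKer` at the step resolvent `KInvStep Lc j` -/

section Identity

variable {Lc : ℕ} [NeZero Lc] {r : Fin (d + 1) → ℕ}

omit [NeZero Lc] in
/-- [folklore] **THE VERTEX OF THE TOP Λ INCREMENT** (every `M`, `N`, `Lc ≥ 1`): by leaf-10-g12's vertex insertion `TaylorLamBracket.vertex_lagrInc_top`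
(EL identity, `𝒬_N ℋ_N = δ`, gauge multiplier `≡ 0`) the chain-rule vertex of `symLagrIncAt d (toSite r) Lc M N` at the coarse bond `(κ′, u′)` is the `M`-LIFT of the
superposition of an1's constraint Hessians with coefficients the top multiplier kernel `wΦ_N κ′ μ (u′ − yy)` (an4's `avgLift_wsum` moves the lift out of
the absolutely convergent superposition; `decay_wΦ`, `biLoc_symHessFFAt`). -/
theorem vertexOf_lagrInc_top {N : ℕ} [NeZero N] (M : ℕ) [NeZero M] (hLc : 1 ≤ Lc) (hr : r ∈ box (d + 1) Lc) (κ' : Fin (d + 1)) (u' : Fin (d + 1) → ℤ) :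
    vertexOf (N := N) (symLagrIncAt d (toSite r) Lc M N) κ' u' =
      avgLift M (fun w y a b => ∑ μ : Fin (d + 1), wsum (fun yy => wΦ (N := N) κ' μ (u' - yy)) (symHessFFAt (toSite r) Lc μ) w y a b) := by
  obtain ⟨δ, C, hδ, hΦ⟩ := decay_wΦ (N := N) (d := d)
  have hw : ∀ μ : Fin (d + 1), ∀ yy : Fin (d + 1) → ℤ,
      |wΦ (N := N) κ' μ (u' - yy)| ≤ C * Real.exp (-δ * l1 (yy - u')) := fun μ yy => by
    rw [l1_sub_symm]
    exact hΦ κ' μ (u' - yy)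
  have hG : ∀ μ : Fin (d + 1), ∀ yy x w : Fin (d + 1) → ℤ, ∀ a b : Fib d,
      |symHessFFAt (toSite r) (d := d) Lc μ yy x w a b| ≤ 2 * (ell (d + 1) Lc : ℝ) ^ 2 := fun μ yy x w a b => by
    simpa using biLoc_symHessFFAt (d := d) hLc μ yy hr le_rfl x w a b
  have e := avgLift_finset_sum Finset.univ M (fun μ : Fin (d + 1) => wsum (fun yy => wΦ (N := N) κ' μ (u' - yy)) (symHessFFAt (toSite r) Lc μ))
  rw [show (fun w y a b => ∑ μ : Fin (d + 1), wsum (fun yy => wΦ (N := N) κ' μ (u' - yy)) (symHessFFAt (toSite r) Lc μ) w y a b) =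
      (fun x w a b => ∑ μ ∈ Finset.univ, (fun μ : Fin (d + 1) => wsum (fun yy => wΦ (N := N) κ' μ (u' - yy)) (symHessFFAt (toSite r) Lc μ)) μ x w a b)
      from rfl, e]
  funext w y a b
  show ∑ κ'' : Fin (d + 1), ∑' u : Fin (d + 1) → ℤ, wH (N := N) κ'' κ' (u - (N : ℤ) • u') * symLagrIncAt d (toSite r) Lc M N κ'' u w y a b = _
  rw [vertex_symLagrIncAt_top (N := N) M hLc hr κ' u' w y a b]
  refine Finset.sum_congr rfl fun μ _ => ?_
  rw [avgLift_wsum M (hw μ) hδ (hG μ)]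
  rfl

/-- [folklore] **THE COEFFICIENTS ARE THE STEP RESOLVENT'S `mm` BLOCK** (`N = Lc^{j+1}`): `wΦ_N κ′ μ (u′ − yy) = KInv_N (N•u′) (N•yy) (inr κ′) (inr μ)`
(`KInv_inr_inr_coarse`) `= KInvStep Lc j (Lc•u′) (Lc•yy) (inr κ′) (inr μ)` (`SecondOrderUnits.KInvStep_mm_eq_KInv_mm`), so the `wΦ_N`-superposition is
`lamTopMidAt (toSite r) Lc (KInvStep Lc j) κ′ u′`. -/
theorem wPhiMid_eq_lamTopMid (j : ℕ) (κ' : Fin (d + 1)) (u' : Fin (d + 1) → ℤ) :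
    (fun w y a b => ∑ μ : Fin (d + 1), wsum (fun yy => wΦ (N := Lc ^ (j + 1)) κ' μ (u' - yy)) (symHessFFAt (toSite r) Lc μ) w y a b) =
      lamTopMidAt (toSite r) Lc (KInvStep (d := d) Lc j) κ' u' := by
  funext w y a b
  simp only [lamTopMid_apply, wsum]
  refine Finset.sum_congr rfl fun μ _ => tsum_congr fun yy => ?_
  rw [KInvStep_mm_eq_KInv_mm, KInv_inr_inr_coarse]

/-- [folklore] **THE TOP Λ PIECE IS THE TRILINEAR FUNCTIONAL AT THE STEP RESOLVENT** (member `j+1`: `N = Lc^{j+1}`, `M = Lc^j`; any scalar weight `c`):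
`e3OfS N (c • symLagrIncAt d (toSite r) Lc M N) κ′ u′ = c • lamTopKerAt (toSite r) Lc K̃_j K̃_j K̃_j κ′ u′`, `K̃_j = KInvStep Lc j = dec M (KInv N)`.  Chain: `vertexOf_smul` +
`vertexOf_lagrInc_top` + `wPhiMid_eq_lamTopMid` (the vertex is `c • avgLift M (lamTopMidAt (toSite r) Lc K̃_j κ′ u′)`), scalars through `comp`∕`mmRead`, `mmRead_pow_succ`,
and an2's `dec_comp_avgLift_comp` (`dec M (KInv ∘ avgLift M V ∘ KInv) = dec M KInv ∘ V ∘ dec M KInv`, absolute convergence from `decays_KInv` and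
`biLoc_lamTopMid` ∘ `decays_KInvStep`). -/
theorem e3OfS_lamTop_eq (hLc : 1 ≤ Lc) (hr : r ∈ box (d + 1) Lc) (c : ℝ) (j : ℕ) (κ' : Fin (d + 1)) (u' : Fin (d + 1) → ℤ) :
    e3OfS (Lc ^ (j + 1)) (fun κ u => c • symLagrIncAt d (toSite r) Lc (Lc ^ j) (Lc ^ (j + 1)) κ u) κ' u' =
      c • lamTopKerAt (toSite r) Lc (KInvStep (d := d) Lc j) (KInvStep (d := d) Lc j) (KInvStep (d := d) Lc j) κ' u' := by
  -- the vertex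
  have hV : vertexOf (N := Lc ^ (j + 1)) (fun κ u => c • symLagrIncAt d (toSite r) Lc (Lc ^ j) (Lc ^ (j + 1)) κ u) κ' u' =
      c • avgLift (Lc ^ j) (lamTopMidAt (toSite r) Lc (KInvStep (d := d) Lc j) κ' u') := by
    rw [vertexOf_smul, vertexOf_lagrInc_top (Lc ^ j) hLc hr, wPhiMid_eq_lamTopMid]
  -- absolute convergence data for the decimation identity
  obtain ⟨δK, CK, hδK, _, hK⟩ := decays_KInv (N := Lc ^ (j + 1)) (d := d)
  obtain ⟨δS, CS, hδS, _, hS⟩ := decays_KInvStep (Lc := Lc) (d := d) j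
  have hVb := biLoc_lamTopMid hLc hr hS hδS κ' u'
  have hdec := dec_comp_avgLift_comp (Lc ^ j) hK hδK.le hK hδK.le hVb (half_pos hδS)
  funext x' z' a b
  show -(mmRead (Lc ^ (j + 1)) (comp (comp (KInv (N := Lc ^ (j + 1)) (d := d))
      (vertexOf (N := Lc ^ (j + 1)) (fun κ u => c • symLagrIncAt d (toSite r) Lc (Lc ^ j) (Lc ^ (j + 1)) κ u) κ' u'))
      (KInv (N := Lc ^ (j + 1)) (d := d))) x' z' a b) = _
  rw [hV, KernelReflection.comp_smul_right, KernelReflection.comp_smul_left, mmRead_smul, mmRead_pow_succ, hdec]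
  simp only [lamTopKerAt, Pi.smul_apply, smul_eq_mul, mul_neg]
  rfl

/-- [folklore] **THE TOP Λ PIECE IN THE K-SLOT'S UNITS** — THE WEIGHT CANCELS EXACTLY: with `K̃ᵘ_j = unitK (sfStep Lc j) (smStep d Lc j) (KInvStep Lc j)`
(field legs `×Lc^j`, multiplier legs `×Lc^{j(d+1)}` — the units of `CombesThomas.UnitDecayK`∕`CauchyDecayK`),
`N^{2(d+1)} · e3OfS N ((cΛ·M^{2d+4}) • symLagrIncAt d (toSite r) Lc M N) κ′ u′ = cΛ·Lc^{2(d+1)} · lamTopKerAt (toSite r) Lc K̃ᵘ_j K̃ᵘ_j K̃ᵘ_j κ′ u′` (entrywise; `N = Lc^{j+1}`, `M = Lc^j`). -/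
theorem unit_e3OfS_lamTop_eq (hLc : 1 ≤ Lc) (hr : r ∈ box (d + 1) Lc) (cΛ : ℝ) (j : ℕ) (κ' : Fin (d + 1)) (u' x' z' : Fin (d + 1) → ℤ) (a b : Fib d) :
    ((Lc : ℝ) ^ (j + 1)) ^ (2 * (d + 1)) *
        e3OfS (Lc ^ (j + 1)) (fun κ u => (cΛ * ((Lc : ℝ) ^ j) ^ (2 * d + 4)) • symLagrIncAt d (toSite r) Lc (Lc ^ j) (Lc ^ (j + 1)) κ u) κ' u' x' z' a b =
      cΛ * (Lc : ℝ) ^ (2 * (d + 1)) *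
        lamTopKerAt (toSite r) Lc (unitK (CombesThomas.sfStep Lc j) (CombesThomas.smStep d Lc j) (KInvStep (d := d) Lc j))
          (unitK (CombesThomas.sfStep Lc j) (CombesThomas.smStep d Lc j) (KInvStep (d := d) Lc j))
          (unitK (CombesThomas.sfStep Lc j) (CombesThomas.smStep d Lc j) (KInvStep (d := d) Lc j)) κ' u' x' z' a b := by
  rw [e3OfS_lamTop_eq hLc hr, lamTopKer_unitK]
  simp only [Pi.smul_apply, smul_eq_mul]
  rw [← mul_assoc, weight_arith]
  ring

end Identity

end Summit.QuantumFields.BalabanUV.Beta.GAN24.TopLagrangeKSlotSymAt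

end
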